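import Mathlib
import HarnessLib
import Literature.MathematicalPhysics.QuantumLattice.KohnLuttinger

/-!
# Stub `stub_klHausdorffFinite` (crux `CwKLChiralWindow`, line `Sketch`)

The Fermi curve `F = {k ∈ [-π,π)² | -2(cos k₀ + cos k₁) = μ}` of the nearest-neighbour band has
finite length (`μH[1] F < ∞`) for `μ ∈ (-4, 0)`.  Write `c = -μ/2 ∈ (0, 2)` and
`d = arccos (c/2)`.  Every point of `F` lies on one of the four Lipschitz arcs
`y ↦ (±arccos (c - cos y), y)`, `y ↦ (y, ±arccos (c - cos y))`, `y ∈ [-d, d]`; on `[-d, d]` one has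
`cos y ≥ c/2`, so `u = c - cos y ∈ [c-1, c/2] ⊂ (-1, 1)` and the slope
`|sin y| / √(1 - u²)` is at most `1`.  Lipschitz maps increase `μH[1]` by at most their constant,
and `μH[1] [-d, d] = 2d < ∞`.
-/

noncomputable section

set_option linter.dupNamespace false

namespace Summit.HubbardSuperconductivity.HubbardSuperconductivity.Theorems

open MeasureTheory Literature.MathematicalPhysics.QuantumLattice

/-- Distances in `EuclideanSpace ℝ (Fin 2)` are bounded by the `ℓ¹` distance of the coordinates.
[folklore] -/
theorem kl_hf_dist_mk_le (a b a' b' : ℝ) :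
    dist (WithLp.toLp 2 ![a, b] : Momentum) (WithLp.toLp 2 ![a', b']) ≤ |a - a'| + |b - b'| := by
  rw [EuclideanSpace.dist_eq, Fin.sum_univ_two]
  simp only [Matrix.cons_val_zero, Matrix.cons_val_one, Real.dist_eq]
  rw [Real.sqrt_le_left (by positivity)]
  nlinarith [mul_nonneg (abs_nonneg (a - a')) (abs_nonneg (b - b'))]

/-- A pair of `1`-Lipschitz coordinate functions gives a `2`-Lipschitz map into
`EuclideanSpace ℝ (Fin 2)`. [folklore] -/
theorem kl_hf_lipschitz_mk {X Y : ℝ → ℝ} {S : Set ℝ} (hX : LipschitzOnWith 1 X S)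
    (hY : LipschitzOnWith 1 Y S) :
    LipschitzOnWith 2 (fun y => (WithLp.toLp 2 ![X y, Y y] : Momentum)) S := by
  refine LipschitzOnWith.of_dist_le_mul fun y hy y' hy' => ?_
  have h1 := hX.dist_le_mul y hy y' hy'
  have h2 := hY.dist_le_mul y hy y' hy'
  simp only [NNReal.coe_one, one_mul, Real.dist_eq] at h1 h2
  calc dist (WithLp.toLp 2 ![X y, Y y] : Momentum) (WithLp.toLp 2 ![X y', Y y'])
      ≤ |X y - X y'| + |Y y - Y y'| := kl_hf_dist_mk_le _ _ _ _
    _ ≤ (2 : NNReal) * dist y y' := by rw [Real.dist_eq]; push_cast; linarith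

/-- On `[-arccos (c/2), arccos (c/2)]` one has `cos y ≥ c/2` (`0 < c < 2`). [folklore] -/
theorem kl_hf_cos_ge {c y : ℝ} (hc0 : 0 < c) (hc2 : c < 2)
    (hy : y ∈ Set.Icc (-Real.arccos (c / 2)) (Real.arccos (c / 2))) : c / 2 ≤ Real.cos y := by
  have habs : |y| ≤ Real.arccos (c / 2) := abs_le.2 hy
  have hpi : Real.arccos (c / 2) ≤ Real.pi := Real.arccos_le_pi _
  rw [← Real.cos_abs, ← Real.cos_arccos (x := c / 2) (by linarith) (by linarith)]
  exact Real.cos_le_cos_of_nonneg_of_le_pi (abs_nonneg y) hpi habs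

/-- The arc `y ↦ arccos (c - cos y)` is `1`-Lipschitz on `[-arccos (c/2), arccos (c/2)]`
(`0 < c < 2`): its derivative `-sin y / √(1 - (c - cos y)²)` has absolute value `≤ 1` there.
[folklore] -/
theorem kl_hf_arccos_lipschitz {c : ℝ} (hc0 : 0 < c) (hc2 : c < 2) :
    LipschitzOnWith 1 (fun y => Real.arccos (c - Real.cos y))
      (Set.Icc (-Real.arccos (c / 2)) (Real.arccos (c / 2))) := by
  refine (convex_Icc _ _).lipschitzOnWith_of_nnnorm_hasDerivWithin_le
    (f' := fun y => -(1 / √(1 - (c - Real.cos y) ^ 2)) * Real.sin y)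
    (fun y hy => ?_) (fun y hy => ?_)
  · have hcy := kl_hf_cos_ge hc0 hc2 hy
    have hcos1 := Real.cos_le_one y
    have hu : HasDerivAt (fun y => c - Real.cos y) (Real.sin y) y := by
      simpa using (Real.hasDerivAt_cos y).const_sub c
    have h1 : c - Real.cos y ≠ -1 := by intro h; linarith
    have h2 : c - Real.cos y ≠ 1 := by intro h; linarith
    exact ((Real.hasDerivAt_arccos h1 h2).comp y hu).hasDerivWithinAt
  · have hcy := kl_hf_cos_ge hc0 hc2 hy
    have hcos1 := Real.cos_le_one y
    have hpos : 0 < 1 - (c - Real.cos y) ^ 2 := by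
      nlinarith [mul_pos (show 0 < 1 - (c - Real.cos y) by linarith)
        (show 0 < 1 + (c - Real.cos y) by linarith)]
    have hsqrt : 0 < √(1 - (c - Real.cos y) ^ 2) := Real.sqrt_pos.2 hpos
    have hsin : |Real.sin y| ≤ √(1 - (c - Real.cos y) ^ 2) := by
      apply Real.abs_le_sqrt
      rw [Real.sin_sq]
      nlinarith [mul_nonneg hc0.le (show 0 ≤ 2 * Real.cos y - c by linarith)]
    rw [← NNReal.coe_le_coe, coe_nnnorm, NNReal.coe_one, norm_mul, norm_neg, Real.norm_eq_abs,
      Real.norm_eq_abs, abs_of_pos (one_div_pos.2 hsqrt), one_div_mul_eq_div, div_le_one hsqrt]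
    exact hsin

/-- One branch of the covering: if `cos a + cos b = c`, `|a|, |b| ≤ π` and `|b| ≤ |a|`, then
`b ∈ [-arccos (c/2), arccos (c/2)]` and `a = ±arccos (c - cos b)`. [folklore] -/
theorem kl_hf_branch {c a b : ℝ} (hsum : Real.cos a + Real.cos b = c) (ha : |a| ≤ Real.pi)
    (hb : |b| ≤ Real.pi) (hba : |b| ≤ |a|) :
    b ∈ Set.Icc (-Real.arccos (c / 2)) (Real.arccos (c / 2)) ∧
      (a = Real.arccos (c - Real.cos b) ∨ a = -Real.arccos (c - Real.cos b)) := by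
  have hcos : Real.cos a ≤ Real.cos b := by
    rw [← Real.cos_abs a, ← Real.cos_abs b]
    exact Real.cos_le_cos_of_nonneg_of_le_pi (abs_nonneg b) ha hba
  have hcb : c / 2 ≤ Real.cos b := by linarith
  refine ⟨?_, ?_⟩
  · have h : Real.arccos (Real.cos |b|) ≤ Real.arccos (c / 2) :=
      Real.arccos_le_arccos (by rwa [Real.cos_abs])
    rw [Real.arccos_cos (abs_nonneg b) hb] at h
    exact Set.mem_Icc.2 (abs_le.1 h)
  · have h : |a| = Real.arccos (c - Real.cos b) := by
      rw [← Real.arccos_cos (abs_nonneg a) ha, Real.cos_abs]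
      congr 1
      linarith
    exact (abs_eq (Real.arccos_nonneg _)).1 h

/-- **Covering of the Fermi curve by four arcs**: for `c = -μ/2`, every point of
`fermiCurve (squareDispersion 1 0) μ` lies on one of the graphs `y ↦ (±arccos (c - cos y), y)`,
`y ↦ (y, ±arccos (c - cos y))` over `[-arccos (c/2), arccos (c/2)]`. [folklore] -/
theorem kl_hf_cover {μ c : ℝ} (hc : c = -μ / 2) :
    fermiCurve (squareDispersion 1 0) μ ⊆
      ((fun y => (WithLp.toLp 2 ![Real.arccos (c - Real.cos y), y] : Momentum)) ''
          Set.Icc (-Real.arccos (c / 2)) (Real.arccos (c / 2)) ∪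
        (fun y => (WithLp.toLp 2 ![-Real.arccos (c - Real.cos y), y] : Momentum)) ''
          Set.Icc (-Real.arccos (c / 2)) (Real.arccos (c / 2))) ∪
      ((fun y => (WithLp.toLp 2 ![y, Real.arccos (c - Real.cos y)] : Momentum)) ''
          Set.Icc (-Real.arccos (c / 2)) (Real.arccos (c / 2)) ∪
        (fun y => (WithLp.toLp 2 ![y, -Real.arccos (c - Real.cos y)] : Momentum)) ''
          Set.Icc (-Real.arccos (c / 2)) (Real.arccos (c / 2))) := by
  intro k hk
  obtain ⟨hBZ, hε⟩ := hk
  have h0 := hBZ 0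
  have h1 := hBZ 1
  simp only [Set.mem_Ico] at h0 h1
  have hsum : Real.cos (k 0) + Real.cos (k 1) = c := by
    simp only [squareDispersion] at hε
    rw [hc]
    linarith
  have hx : |k 0| ≤ Real.pi := abs_le.2 ⟨h0.1, h0.2.le⟩
  have hy : |k 1| ≤ Real.pi := abs_le.2 ⟨h1.1, h1.2.le⟩
  rcases le_total |k 1| |k 0| with hle | hle
  · obtain ⟨hS, heq | heq⟩ := kl_hf_branch hsum hx hy hle
    · refine Set.mem_union_left _ (Set.mem_union_left _ ⟨k 1, hS, ?_⟩)
      ext i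
      fin_cases i
      · simpa using heq.symm
      · simp
    · refine Set.mem_union_left _ (Set.mem_union_right _ ⟨k 1, hS, ?_⟩)
      ext i
      fin_cases i
      · simpa using heq.symm
      · simp
  · rw [add_comm] at hsum
    obtain ⟨hS, heq | heq⟩ := kl_hf_branch hsum hy hx hle
    · refine Set.mem_union_right _ (Set.mem_union_left _ ⟨k 0, hS, ?_⟩)
      ext i
      fin_cases i
      · simp
      · simpa using heq.symm
    · refine Set.mem_union_right _ (Set.mem_union_right _ ⟨k 0, hS, ?_⟩)
      ext i
      fin_cases i
      · simp
      · simpa using heq.symm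

/-- **Stub `stub_klHausdorffFinite`**: the Fermi curve `{k ∈ [-π,π)² | -2(cos k₀ + cos k₁) = μ}` has
finite length for `μ ∈ (-4, 0)` (it is covered by four `2`-Lipschitz arcs
`y ↦ (±arccos(c - cos y), y)`, `y ↦ (y, ±arccos(c - cos y))` over `[-d, d]`, `c = -μ/2`,
`d = arccos (c/2)`). [folklore] -/
theorem stub_klHausdorffFinite :
    ∀ μ ∈ Set.Ioo (-4 : ℝ) 0, Measure.hausdorffMeasure 1 (fermiCurve (squareDispersion 1 0) μ) < ⊤ := by
  intro μ hμ
  obtain ⟨hμ1, hμ2⟩ := hμ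
  set c : ℝ := -μ / 2 with hc
  have hc0 : 0 < c := by rw [hc]; linarith
  have hc2 : c < 2 := by rw [hc]; linarith
  set S : Set ℝ := Set.Icc (-Real.arccos (c / 2)) (Real.arccos (c / 2)) with hS
  have hX : LipschitzOnWith 1 (fun y => Real.arccos (c - Real.cos y)) S :=
    kl_hf_arccos_lipschitz hc0 hc2
  have hXn : LipschitzOnWith 1 (fun y => -Real.arccos (c - Real.cos y)) S :=
    LipschitzOnWith.of_dist_le_mul fun y hy y' hy' => by
      rw [dist_neg_neg]
      exact hX.dist_le_mul y hy y' hy'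
  have hid : LipschitzOnWith 1 (fun y : ℝ => y) S := LipschitzWith.id.lipschitzOnWith
  have hSfin : Measure.hausdorffMeasure 1 S < ⊤ := by
    rw [MeasureTheory.hausdorffMeasure_real, hS, Real.volume_Icc]
    exact ENNReal.ofReal_lt_top
  have himg : ∀ {f : ℝ → Momentum}, LipschitzOnWith 2 f S →
      Measure.hausdorffMeasure 1 (f '' S) < ⊤ := by
    intro f hf
    refine lt_of_le_of_lt (hf.hausdorffMeasure_image_le zero_le_one) ?_
    refine ENNReal.mul_lt_top ?_ hSfin
    rw [ENNReal.rpow_one]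
    exact ENNReal.coe_lt_top
  exact lt_of_le_of_lt (measure_mono (kl_hf_cover hc))
    (measure_union_lt_top
      (measure_union_lt_top (himg (kl_hf_lipschitz_mk hX hid)) (himg (kl_hf_lipschitz_mk hXn hid)))
      (measure_union_lt_top (himg (kl_hf_lipschitz_mk hid hX)) (himg (kl_hf_lipschitz_mk hid hXn))))

end Summit.HubbardSuperconductivity.HubbardSuperconductivity.Theorems

end
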